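import Mathlib.Algebra.Algebra.Equiv
import Mathlib.Algebra.CharZero.Infinite
import Mathlib.LinearAlgebra.Matrix.GeneralLinearGroup.Defs
import Literature.LinearAlgebra.Matrix.SimilarityDescent
import HarnessLib

/-!
# The norm map and `σ`-conjugacy on `GL_n` (Arthur–Clozel, Ch. 1, §1)

Arthur–Clozel, *Simple algebras, base change, and the advanced theory of the trace formula*,
Ann. of Math. Stud. 120 (1989), Ch. 1, §1 ("The norm map and the geometry of `σ`-conjugacy"):
`E / F` is a cyclic extension of fields of characteristic `0` with Galois group `Σ = ⟨σ⟩` of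
order `ℓ`, `G = GL(n)`, and

* `g, h ∈ G(E)` are **`σ`-conjugate** if `g = x⁻¹ h x^σ` for some `x ∈ G(E)` (`IsSigmaConj`);
* the **norm** of `x ∈ G(E)` is `N x = x x^σ x^{σ²} ⋯ x^{σ^{ℓ-1}} ∈ G(E)` (`normMap σ ℓ x`; the
  number of factors `ℓ` is kept as an explicit argument, the interesting case being `σ ^ ℓ = 1`).

Proved here (all elementary, the opening lines of the proof of Lemma 1.1):
* `galAct_normMap` / `galAct_normMap_of_pow_eq_one`: `(N x)^σ = x⁻¹ (N x) x` when `σ^ℓ = 1`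
  (Arthur–Clozel, proof of Lemma 1.1 (i): "We have `(Nx)^σ = x⁻¹(Nx)x`"), so the conjugacy
  class of `N x` is `σ`-stable;
* `normMap_conj_galAct`, `IsSigmaConj.isConj_normMap`: the norm of a `σ`-conjugate
  `x⁻¹ h x^σ` is the conjugate `x⁻¹ (N h) x`, so `N` is constant on `σ`-conjugacy classes up to
  conjugacy (the map of Lemma 1.1 (ii) is well defined);
* `normMap_map_algebraMap`: on `G(F)` the norm is `y ↦ y ^ ℓ`;
* `isConj_of_isConj_map_algebraMap` — **Lemma 1.1 (i), uniqueness clause**: an element of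
  `G(E)` is `G(E)`-conjugate to at most one `G(F)`-conjugacy class of elements of `G(F)`, i.e.
  two elements of `G(F)` conjugate in `G(E)` are conjugate in `G(F)`. Arthur–Clozel argue with
  the elementary divisors; here it is the descent of similarity to an infinite base field
  (`Literature.LinearAlgebra.Matrix.isConj_of_isConj_map`, fields of characteristic `0` being
  infinite), which avoids the rational canonical form.

NOT here (the remaining content of Lemma 1.1, which needs the uniqueness of invariant factors
over `E[X]` or, equivalently, Galois descent plus Hilbert's Theorem 90 for the twisted
centralizer `G_{x,σ}` — neither is in Mathlib): the *existence* clause of (i) (`N x` is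
`G(E)`-conjugate to an element of `G(F)`) and (ii) (injectivity of `N` on `σ`-conjugacy classes).
No named facts are introduced for them.

## References
* J. Arthur, L. Clozel, *Simple algebras, base change, and the advanced theory of the trace
  formula*, Ann. of Math. Stud. 120 (1989), Ch. 1, §1, Lemma 1.1.
* R. P. Langlands, *Base change for `GL(2)`*, Ann. of Math. Stud. 96 (1980), §4.
-/

namespace Literature.NumberTheory.Automorphic

namespace ArthurClozel

variable {F E : Type*} [Field F] [Field E] [Algebra F E] {n : Type*} [Fintype n] [DecidableEq n]

/-! ### The Galois action on `GL_n(E)` -/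

/-- The action `x ↦ x^σ` of an automorphism `σ ∈ Aut(E/F)` on `GL_n(E)`, entrywise
(Mathlib's `Matrix.GeneralLinearGroup.map` of the ring homomorphism underlying `σ`); a group
homomorphism. [folklore] -/
abbrev galAct (σ : E ≃ₐ[F] E) : GL n E →* GL n E :=
  Matrix.GeneralLinearGroup.map (σ : E →+* E)

/-- `(x^σ)_{ij} = σ(x_{ij})` (definitional). [folklore] -/
@[simp]
theorem galAct_apply (σ : E ≃ₐ[F] E) (x : GL n E) (i j : n) :
    (galAct σ x : Matrix n n E) i j = σ (x i j) :=
  Matrix.GeneralLinearGroup.map_apply _ _ _ _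

/-- `x^{στ} = (x^τ)^σ`: the entrywise action is a (left) action of `Aut(E/F)`. [folklore] -/
theorem galAct_mul (σ τ : E ≃ₐ[F] E) (x : GL n E) : galAct (σ * τ) x = galAct σ (galAct τ x) := by
  ext i j
  simp [AlgEquiv.mul_apply]

/-- The identity automorphism acts trivially. [folklore] -/
@[simp]
theorem galAct_one (x : GL n E) : galAct (1 : E ≃ₐ[F] E) x = x := by
  ext i j
  simp

/-- `G(F) ⊆ G(E)` is fixed by the Galois action: `y^σ = y` for `y ∈ GL_n(F)` (`σ` is
`F`-linear). [folklore] -/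
@[simp]
theorem galAct_map_algebraMap (σ : E ≃ₐ[F] E) (y : GL n F) :
    galAct σ (Matrix.GeneralLinearGroup.map (algebraMap F E) y) =
      Matrix.GeneralLinearGroup.map (algebraMap F E) y := by
  ext i j
  simp

/-! ### The norm map -/

/-- The **norm map** of Arthur–Clozel, Ch. 1, §1: `N x = x x^σ x^{σ²} ⋯ x^{σ^{ℓ-1}} ∈ GL_n(E)`
for `x ∈ GL_n(E)`, `σ ∈ Aut(E/F)` and a number of factors `ℓ` (in the source `ℓ = |Gal(E/F)|`
with `σ` a generator, so that `σ^ℓ = 1`; `ℓ` need not be prime). Defined recursively: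
`N₀ x = 1`, `N_{ℓ+1} x = N_ℓ x · x^{σ^ℓ}`. [cite: ArthurClozelAMS120, Ch. 1, §1] -/
def normMap (σ : E ≃ₐ[F] E) : ℕ → GL n E → GL n E
  | 0, _ => 1
  | ℓ + 1, x => normMap σ ℓ x * galAct (σ ^ ℓ) x

/-- `N₀ x = 1` (empty product). [folklore] -/
@[simp]
theorem normMap_zero (σ : E ≃ₐ[F] E) (x : GL n E) : normMap σ 0 x = 1 := rfl

/-- `N_{ℓ+1} x = N_ℓ x · x^{σ^ℓ}`. [folklore] -/
theorem normMap_succ (σ : E ≃ₐ[F] E) (ℓ : ℕ) (x : GL n E) :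
    normMap σ (ℓ + 1) x = normMap σ ℓ x * galAct (σ ^ ℓ) x := rfl

/-- `N₁ x = x`. [folklore] -/
@[simp]
theorem normMap_one (σ : E ≃ₐ[F] E) (x : GL n E) : normMap σ 1 x = x := by
  rw [normMap_succ, normMap_zero, one_mul, pow_zero, galAct_one]

/-- **`(N x)^σ = x⁻¹ · N x · x^{σ^ℓ}`** for any number of factors `ℓ`: applying `σ` shifts the
product `x x^σ ⋯ x^{σ^{ℓ-1}}` to `x^σ ⋯ x^{σ^ℓ}` (Arthur–Clozel, proof of Lemma 1.1 (i)).
[cite: ArthurClozelAMS120, Ch. 1, Lemma 1.1] -/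
theorem galAct_normMap (σ : E ≃ₐ[F] E) (ℓ : ℕ) (x : GL n E) :
    galAct σ (normMap σ ℓ x) = x⁻¹ * normMap σ ℓ x * galAct (σ ^ ℓ) x := by
  induction ℓ with
  | zero => simp
  | succ ℓ ih =>
    rw [normMap_succ, map_mul, ih, ← galAct_mul, ← pow_succ']
    simp only [mul_assoc]

/-- **`(N x)^σ = x⁻¹ (N x) x` when `σ^ℓ = 1`** — the identity "`(Nx)^σ = x⁻¹(Nx)x`" of
Arthur–Clozel, proof of Lemma 1.1 (i): the `GL_n(E)`-conjugacy class of `N x` is `σ`-stable.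
[cite: ArthurClozelAMS120, Ch. 1, Lemma 1.1] -/
theorem galAct_normMap_of_pow_eq_one {σ : E ≃ₐ[F] E} {ℓ : ℕ} (hσ : σ ^ ℓ = 1) (x : GL n E) :
    galAct σ (normMap σ ℓ x) = x⁻¹ * normMap σ ℓ x * x := by
  rw [galAct_normMap, hσ, galAct_one]

/-- When `σ^ℓ = 1`, `N x` and `(N x)^σ` are conjugate in `GL_n(E)` (Arthur–Clozel, proof of
Lemma 1.1 (i)). [cite: ArthurClozelAMS120, Ch. 1, Lemma 1.1] -/
theorem isConj_normMap_galAct_normMap {σ : E ≃ₐ[F] E} {ℓ : ℕ} (hσ : σ ^ ℓ = 1) (x : GL n E) :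
    IsConj (normMap σ ℓ x) (galAct σ (normMap σ ℓ x)) := by
  rw [galAct_normMap_of_pow_eq_one hσ, isConj_iff]
  exact ⟨x⁻¹, by rw [inv_inv]⟩

/-- **The norm of a `σ`-conjugate is a conjugate**: `N (g⁻¹ h g^σ) = g⁻¹ · N h · g^{σ^ℓ}` (the
product telescopes); with `σ^ℓ = 1` this is `g⁻¹ (N h) g` (Arthur–Clozel, Ch. 1, §1, the map
`𝒩` of Lemma 1.1 (ii) is well defined on `σ`-conjugacy classes). [cite: ArthurClozelAMS120, Ch. 1, Lemma 1.1] -/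
theorem normMap_conj_galAct (σ : E ≃ₐ[F] E) (ℓ : ℕ) (g h : GL n E) :
    normMap σ ℓ (g⁻¹ * h * galAct σ g) = g⁻¹ * normMap σ ℓ h * galAct (σ ^ ℓ) g := by
  induction ℓ with
  | zero => simp
  | succ ℓ ih =>
    rw [normMap_succ, ih, normMap_succ, map_mul, map_mul, map_inv, ← galAct_mul, ← pow_succ]
    simp only [mul_assoc, mul_inv_cancel_left]

/-- **On `G(F)` the norm is the `ℓ`-th power**: `N y = y ^ ℓ` for `y ∈ GL_n(F) ⊆ GL_n(E)`
(Arthur–Clozel, Ch. 1, §1). [cite: ArthurClozelAMS120, Ch. 1, §1] -/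
theorem normMap_map_algebraMap (σ : E ≃ₐ[F] E) (ℓ : ℕ) (y : GL n F) :
    normMap σ ℓ (Matrix.GeneralLinearGroup.map (algebraMap F E) y) =
      Matrix.GeneralLinearGroup.map (algebraMap F E) (y ^ ℓ) := by
  induction ℓ with
  | zero => simp
  | succ ℓ ih => rw [normMap_succ, ih, galAct_map_algebraMap, ← map_mul, ← pow_succ]

/-- The determinant of the norm is the product of the Galois conjugates of the determinant:
`det (N x) = ∏_{i<ℓ} σ^i (det x)` (for `σ` generating `Gal(E/F)` of order `ℓ` this is the field
norm `N_{E/F}(det x)`). [folklore] -/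
theorem det_normMap (σ : E ≃ₐ[F] E) (ℓ : ℕ) (x : GL n E) :
    Matrix.GeneralLinearGroup.det (normMap σ ℓ x) =
      ∏ i ∈ Finset.range ℓ, Units.map (((σ ^ i : E ≃ₐ[F] E) : E →+* E) : E →* E)
        (Matrix.GeneralLinearGroup.det x) := by
  induction ℓ with
  | zero => simp
  | succ ℓ ih =>
    rw [normMap_succ, map_mul, ih, Finset.prod_range_succ, Matrix.GeneralLinearGroup.map_det]

/-! ### `σ`-conjugacy -/

/-- **`σ`-conjugacy** (Arthur–Clozel, Ch. 1, §1): `g, h ∈ GL_n(E)` are `σ`-conjugate if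
`g = x⁻¹ h x^σ` for some `x ∈ GL_n(E)`. [cite: ArthurClozelAMS120, Ch. 1, §1] -/
def IsSigmaConj (σ : E ≃ₐ[F] E) (g h : GL n E) : Prop :=
  ∃ x : GL n E, g = x⁻¹ * h * galAct σ x

/-- `σ`-conjugacy is reflexive (`x = 1`). [folklore] -/
theorem IsSigmaConj.refl (σ : E ≃ₐ[F] E) (g : GL n E) : IsSigmaConj σ g g :=
  ⟨1, by simp⟩

/-- `σ`-conjugacy is symmetric: `g = x⁻¹ h x^σ` gives `h = (x⁻¹)⁻¹ g (x⁻¹)^σ`. [folklore] -/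
theorem IsSigmaConj.symm {σ : E ≃ₐ[F] E} {g h : GL n E} (hgh : IsSigmaConj σ g h) :
    IsSigmaConj σ h g := by
  obtain ⟨x, rfl⟩ := hgh
  exact ⟨x⁻¹, by simp [mul_assoc]⟩

/-- `σ`-conjugacy is transitive (`x`, then `y`: use `y x`). [folklore] -/
theorem IsSigmaConj.trans {σ : E ≃ₐ[F] E} {g h k : GL n E} (hgh : IsSigmaConj σ g h)
    (hhk : IsSigmaConj σ h k) : IsSigmaConj σ g k := by
  obtain ⟨x, rfl⟩ := hgh
  obtain ⟨y, rfl⟩ := hhk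
  exact ⟨y * x, by simp [mul_assoc]⟩

/-- `σ`-conjugacy is an equivalence relation on `GL_n(E)`. [folklore] -/
theorem isSigmaConj_equivalence (σ : E ≃ₐ[F] E) :
    Equivalence (IsSigmaConj (n := n) σ) :=
  ⟨IsSigmaConj.refl σ, IsSigmaConj.symm, IsSigmaConj.trans⟩

/-- For `σ = 1`, `σ`-conjugacy is ordinary conjugacy. [folklore] -/
theorem isSigmaConj_one_iff (g h : GL n E) : IsSigmaConj (1 : E ≃ₐ[F] E) g h ↔ IsConj h g := by
  rw [isConj_iff]
  constructor
  · rintro ⟨x, rfl⟩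
    exact ⟨x⁻¹, by simp⟩
  · rintro ⟨c, rfl⟩
    exact ⟨c⁻¹, by simp⟩

/-- **`σ`-conjugate elements have conjugate norms** (when `σ^ℓ = 1`): if `g = x⁻¹ h x^σ` then
`N g = x⁻¹ (N h) x` (`normMap_conj_galAct`), so the norm induces a map from `σ`-conjugacy
classes in `G(E)` to conjugacy classes in `G(E)` — the easy half of Arthur–Clozel, Lemma 1.1
(ii). [cite: ArthurClozelAMS120, Ch. 1, Lemma 1.1] -/
theorem IsSigmaConj.isConj_normMap {σ : E ≃ₐ[F] E} {ℓ : ℕ} (hσ : σ ^ ℓ = 1) {g h : GL n E}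
    (hgh : IsSigmaConj σ g h) : IsConj (normMap σ ℓ g) (normMap σ ℓ h) := by
  obtain ⟨x, rfl⟩ := hgh
  rw [normMap_conj_galAct, hσ, galAct_one, isConj_iff]
  exact ⟨x, by simp [mul_assoc]⟩

/-! ### Lemma 1.1 (i): the `G(F)`-class attached to an element of `G(E)` is unique -/

/-- **Arthur–Clozel, Lemma 1.1 (i), uniqueness clause.** Let `E / F` be fields of
characteristic `0` and `u ∈ GL_n(E)`. If `y, y' ∈ GL_n(F)` are both `GL_n(E)`-conjugate to `u`,
then `y` and `y'` are conjugate in `GL_n(F)`: the element `y ∈ G(F)` conjugate to `N x` in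
Lemma 1.1 (i) "is uniquely defined modulo conjugation in `G(F)`". Arthur–Clozel (following
Langlands, *Base change for `GL(2)`*, §4) read this off the elementary divisors; here it follows
from the descent of similarity to an infinite base field
(`Literature.LinearAlgebra.Matrix.isConj_of_isConj_map`), a field of characteristic `0` being
infinite. [cite: ArthurClozelAMS120, Ch. 1, Lemma 1.1] -/
theorem isConj_of_isConj_map_algebraMap [CharZero F] {y y' : GL n F} {u : GL n E}
    (hy : IsConj (Matrix.GeneralLinearGroup.map (algebraMap F E) y) u)
    (hy' : IsConj (Matrix.GeneralLinearGroup.map (algebraMap F E) y') u) : IsConj y y' :=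
  Literature.LinearAlgebra.Matrix.isConj_of_isConj_map y y' (hy.trans hy'.symm)

end ArthurClozel

end Literature.NumberTheory.Automorphic
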